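import Summits.Ventures.LatticeQCDFlow.Scaling.GraphSchemeFreshness
import Summits.Ventures.LatticeQCDFlow.Scaling.GraphSchemeWilsonFloor

/-!
HONEST FRAMING: exact (Metropolis-corrected) sampling algorithms for lattice gauge theory; figures
of merit are autocorrelation/cost numbers at stated couplings and volumes; no continuum-physics
claim.

# GraphSchemeMixingCeiling — THE GROUND STATE DECIDES: FOR A HOMOGENEOUS EXCHANGE SCHEME ON ANY SWAP LIST, A POSITIVE SOLUTION `c ≥ c_min > 0` OF THE VERTEX EQUATIONS WITH RATE `ρ`
# GIVES `d(n) ≤ (1−ρ)ⁿ·(Σ_kc_k)/c_min`, **`t_mix(ε) ≤ ⌈(1/ρ)·log(Σ_kc_k/(c_min·ε))⌉`**, AND WITH FILE 2 THE TWO-SIDED LAW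
# **`((1−ρ)/ρ)·log((1−ν(u))Σ_kc_k/(4D)) ≤ t_mix(1/4) ≤ ⌈(1/ρ)·log(4Σ_kc_k/c_min)⌉`** (lean-2 GEN-47, ours)

Venture-side (OURS).  Cell `lqcd-flow` (pub-lqcd), unit `pub-lqcd-lean-2-g47`, 2026-08-31.  Chapter AH (the hub–ladder interpolation), file 7 — the abstract ceiling and the two-sided law modulo the
ground state.  Setting of files 4–6: the lazy homogeneous scheme `P = t·T_e + h·R + (1−t−h)·I` on a swap list `e` with distinct endpoints (`m ≥ 1`, `t, h > 0`, `t + h ≤ 1`, one positive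
law `ν`, exact hot sampler), or the weighted scheme `t·ptGraphSwap ν^{⊗} e 1 + (1−t)·prodKernel w M` with idle cold kernels (`h = (1−t)w_0`, file 5's `graphScheme_lazyForm`).  INPUT: a
vector `c` with every `c_k ≥ c_min > 0` and a rate `0 < ρ < 1` solving the vertex equations of file 1.  OUTPUT: freshness (file 6) and the exact Lyapunov weight (file 4) give the ceiling;
file 2 gives the floor with the same `c`, `ρ`.  For the path `1/ρ ≍ max{K³/t, K/h}` and `Σc/c_min ≤ √2K(K+1)(2K+1)/t` (chapter AG); for the star `1/ρ ≍ K·max{1/t, 1/h}` (file 3; there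
`c_min = x` and the hub-list ceiling of chapters L ∕ M is sharper); for a general connected swap graph the Robin ground state of `(t/m)L_G + h·e_0e_0ᵀ` is the one missing input.  No definitions.

* **`graphLazy_isRowStochastic`**, **`graphScheme_worstTvDist_le_mode`** (`d(n) ≤ (1−ρ)ⁿΣ_kc_k/c_min`), **`graphScheme_worstTvDist_le_of_ge_log`**, **`graphScheme_mixingTime_le_mode`**
  (`t_mix(ε) ≤ ⌈(1/ρ)·log(Σ_kc_k/(c_minε))⌉`), **`graphScheme_mixingTime_two_sided_mode`** (with file 2, for the weighted scheme).

Literature grade (cell rule): OWN; nothing cited; no new bib keys.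
-/

noncomputable section

open Finset Function Real
open Literature.Probability.MarkovChains

namespace Summit.Ventures.LatticeQCDFlow.Scaling

variable {S : Type*} [Fintype S] [DecidableEq S] {K m : ℕ} (e : Fin m → Fin (K + 1) × Fin (K + 1)) {ν : S → ℝ} {M : Fin (K + 1) → S → S → ℝ} {w : Fin (K + 1) → ℝ} {t h : ℝ}
  {P : (Fin (K + 1) → S) → (Fin (K + 1) → S) → ℝ}

/-- The lazy homogeneous scheme `t·T_e + h·R + (1−t−h)·I` is a transition matrix (`m ≥ 1`, `t, h ≥ 0`, `t + h ≤ 1`, `M_0` row-stochastic). [ours] -/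
theorem graphLazy_isRowStochastic (hm : 1 ≤ m) (ht0 : 0 ≤ t) (hh0 : 0 ≤ h) (hth : t + h ≤ 1) (hM : ∀ k, IsRowStochastic (M k))
    (hP : ∀ x y, P x y = t * ptGraphProposal e (fun _ => Equiv.refl S) x y + h * coordKernel M 0 x y + (1 - t - h) * (if y = x then 1 else 0)) :
    IsRowStochastic P := by
  refine ⟨fun x y => ?_, fun x => ?_⟩
  · rw [hP]
    exact add_nonneg (add_nonneg (mul_nonneg ht0 (ptGraphProposal_nonneg e _ x y)) (mul_nonneg hh0 (coordKernel_nonneg M (fun j u v => (hM j).1 u v) 0 x y)))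
      (mul_nonneg (by linarith) (by split_ifs <;> norm_num))
  · simp_rw [hP, sum_add_distrib, ← mul_sum, sum_ptGraphProposal_eq_one hm e _ x, sum_coordKernel_zero_eq_one hM, sum_ite_eq' univ x, if_pos (mem_univ _)]
    ring

/-- **`d(n) ≤ (1−ρ)ⁿ·(Σ_kc_k)/c_min` FROM A POSITIVE SOLUTION OF THE VERTEX EQUATIONS** (lazy homogeneous scheme on any list with distinct endpoints; `m ≥ 1`, `t, h > 0`, `t + h ≤ 1`,
`ν > 0` a probability vector, exact hot sampler; `c_k ≥ c_min > 0`, `0 < ρ ≤ 1`). [ours] -/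
theorem graphScheme_worstTvDist_le_mode (hm : 1 ≤ m) (he : ∀ r, (e r).1 ≠ (e r).2) (ht0 : 0 < t) (hh0 : 0 < h) (hth : t + h ≤ 1) (hν : ∀ v, 0 < ν v) (hν1 : ∑ v, ν v = 1)
    (hM : ∀ k, IsRowStochastic (M k)) (hM0 : ∀ u v, M 0 u v = ν v)
    (hP : ∀ x y, P x y = t * ptGraphProposal e (fun _ => Equiv.refl S) x y + h * coordKernel M 0 x y + (1 - t - h) * (if y = x then 1 else 0))
    {c : Fin (K + 1) → ℝ} {ρ cmin : ℝ} (hρ0 : 0 < ρ) (hρ1 : ρ ≤ 1) (hcmin : 0 < cmin) (hcge : ∀ k, cmin ≤ c k)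
    (hvertex : ∀ k : Fin (K + 1), t / m * ∑ r : Fin m, ((if k = (e r).1 then c (e r).2 - c (e r).1 else 0) + (if k = (e r).2 then c (e r).1 - c (e r).2 else 0))
      - (if k = 0 then h * c 0 else 0) = -ρ * c k) (n : ℕ) :
    worstTvDist P (tensorFun (fun _ : Fin (K + 1) => ν)) n ≤ (1 - ρ) ^ n * (∑ k : Fin (K + 1), c k) / cmin := by
  classical
  set Q : Finset (Fin (K + 1)) → Finset (Fin (K + 1)) → ℝ := fun D D' => (∑ r : Fin m, t / m * (if D' = D.image (Equiv.swap (e r).1 (e r).2) then (1 : ℝ) else 0))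
      + h * (if D' = D.erase 0 then (1 : ℝ) else 0) + (1 - t - h) * (if D' = D then (1 : ℝ) else 0) with hQ_def
  have hQ : ∀ D D', Q D D' = (∑ r : Fin m, t / m * (if D' = D.image (Equiv.swap (e r).1 (e r).2) then (1 : ℝ) else 0))
      + h * (if D' = D.erase 0 then (1 : ℝ) else 0) + (1 - t - h) * (if D' = D then (1 : ℝ) else 0) := fun D D' => rfl
  have hPst := graphLazy_isRowStochastic e hm ht0.le hh0.le hth hM hP
  have hfresh := graph_worstTvDist_le_stale e hm he ht0.le hh0.le hth hν hν1 hM hM0 hPst hP hQ n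
  have hstale := graphStale_nonempty_le e hm he ht0.le hh0.le hth hQ hρ0 hρ1 hvertex hcmin hcge (univ : Finset (Fin (K + 1))) n
  exact hfresh.trans hstale

/-- **`n ≥ (1/ρ)·log(Σ_kc_k/(c_min·ε))` ⇒ `d(n) ≤ ε`.** [ours] -/
theorem graphScheme_worstTvDist_le_of_ge_log (hm : 1 ≤ m) (he : ∀ r, (e r).1 ≠ (e r).2) (ht0 : 0 < t) (hh0 : 0 < h) (hth : t + h ≤ 1) (hν : ∀ v, 0 < ν v) (hν1 : ∑ v, ν v = 1)
    (hM : ∀ k, IsRowStochastic (M k)) (hM0 : ∀ u v, M 0 u v = ν v)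
    (hP : ∀ x y, P x y = t * ptGraphProposal e (fun _ => Equiv.refl S) x y + h * coordKernel M 0 x y + (1 - t - h) * (if y = x then 1 else 0))
    {c : Fin (K + 1) → ℝ} {ρ cmin : ℝ} (hρ0 : 0 < ρ) (hρ1 : ρ ≤ 1) (hcmin : 0 < cmin) (hcge : ∀ k, cmin ≤ c k)
    (hvertex : ∀ k : Fin (K + 1), t / m * ∑ r : Fin m, ((if k = (e r).1 then c (e r).2 - c (e r).1 else 0) + (if k = (e r).2 then c (e r).1 - c (e r).2 else 0))
      - (if k = 0 then h * c 0 else 0) = -ρ * c k) {ε : ℝ} (hε : 0 < ε) {n : ℕ}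
    (hn : 1 / ρ * Real.log ((∑ k : Fin (K + 1), c k) / (cmin * ε)) ≤ n) :
    worstTvDist P (tensorFun (fun _ : Fin (K + 1) => ν)) n ≤ ε := by
  have h1 := graphScheme_worstTvDist_le_mode e hm he ht0 hh0 hth hν hν1 hM hM0 hP hρ0 hρ1 hcmin hcge hvertex n
  set A : ℝ := ∑ k : Fin (K + 1), c k with hA
  have hA0 : 0 < A := by
    rw [hA]
    calc (0 : ℝ) < cmin := hcmin
      _ ≤ c 0 := hcge 0
      _ ≤ ∑ k : Fin (K + 1), c k := Finset.single_le_sum (fun k _ => le_trans hcmin.le (hcge k)) (mem_univ 0)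
  set L : ℝ := Real.log (A / (cmin * ε)) with hL
  have hexp : Real.exp (-(n * ρ)) ≤ cmin * ε / A := by
    have hεA : Real.exp (-L) = cmin * ε / A := by rw [hL, Real.exp_neg, Real.exp_log (by positivity), inv_div]
    rw [← hεA]
    refine Real.exp_le_exp.mpr (neg_le_neg ?_)
    by_cases hL0 : 0 ≤ L
    · have := mul_le_mul_of_nonneg_right hn hρ0.le
      calc L = 1 / ρ * L * ρ := by field_simp
        _ ≤ n * ρ := this
    · push Not at hL0
      exact le_trans hL0.le (by positivity)
  have hpow : (1 - ρ) ^ n ≤ Real.exp (-(n * ρ)) := by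
    calc (1 - ρ) ^ n ≤ (Real.exp (-ρ)) ^ n := by
          apply pow_le_pow_left₀ (by linarith)
          have := Real.add_one_le_exp (-ρ); linarith
      _ = Real.exp (-(n * ρ)) := by rw [← Real.exp_nat_mul]; ring_nf
  calc worstTvDist P (tensorFun (fun _ : Fin (K + 1) => ν)) n ≤ (1 - ρ) ^ n * A / cmin := h1
    _ ≤ (cmin * ε / A) * A / cmin := by gcongr; exact hpow.trans hexp
    _ = ε := by field_simp

/-- **THE CEILING FROM THE GROUND STATE: `t_mix(ε) ≤ ⌈(1/ρ)·log(Σ_kc_k/(c_min·ε))⌉`.** [ours] -/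
theorem graphScheme_mixingTime_le_mode (hm : 1 ≤ m) (he : ∀ r, (e r).1 ≠ (e r).2) (ht0 : 0 < t) (hh0 : 0 < h) (hth : t + h ≤ 1) (hν : ∀ v, 0 < ν v) (hν1 : ∑ v, ν v = 1)
    (hM : ∀ k, IsRowStochastic (M k)) (hM0 : ∀ u v, M 0 u v = ν v)
    (hP : ∀ x y, P x y = t * ptGraphProposal e (fun _ => Equiv.refl S) x y + h * coordKernel M 0 x y + (1 - t - h) * (if y = x then 1 else 0))
    {c : Fin (K + 1) → ℝ} {ρ cmin : ℝ} (hρ0 : 0 < ρ) (hρ1 : ρ ≤ 1) (hcmin : 0 < cmin) (hcge : ∀ k, cmin ≤ c k)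
    (hvertex : ∀ k : Fin (K + 1), t / m * ∑ r : Fin m, ((if k = (e r).1 then c (e r).2 - c (e r).1 else 0) + (if k = (e r).2 then c (e r).1 - c (e r).2 else 0))
      - (if k = 0 then h * c 0 else 0) = -ρ * c k) {ε : ℝ} (hε : 0 < ε) :
    mixingTime P (tensorFun (fun _ : Fin (K + 1) => ν)) ε ≤ ⌈1 / ρ * Real.log ((∑ k : Fin (K + 1), c k) / (cmin * ε))⌉₊ :=
  mixingTime_le _ _ (graphScheme_worstTvDist_le_of_ge_log e hm he ht0 hh0 hth hν hν1 hM hM0 hP hρ0 hρ1 hcmin hcge hvertex hε (Nat.le_ceil _))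

/-- **THE TWO-SIDED LAW MODULO THE GROUND STATE, for the weighted scheme `t·ptGraphSwap ν^{⊗} e 1 + (1−t)·prodKernel w M`** (idle cold kernels, exact hot sampler, `m ≥ 1`, distinct endpoints,
`0 < t < 1`, `w_0 > 0`, `h = (1−t)w_0`): a positive solution `c ≥ c_min > 0`, `0 < ρ < 1` of the vertex equations with `(c_{i_r} − c_{l_r})² ≤ Δ` and `D² ≥ (tΔ + hc_0²)/ρ` gives
**`((1−ρ)/ρ)·log((1−ν(u))Σ_kc_k/(4D)) ≤ t_mix(1/4) ≤ ⌈(1/ρ)·log(4Σ_kc_k/c_min)⌉`** for every content `u`. [ours] -/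
theorem graphScheme_mixingTime_two_sided_mode (hm : 1 ≤ m) (he : ∀ r, (e r).1 ≠ (e r).2) (hν : ∀ v, 0 < ν v) (hν1 : ∑ v, ν v = 1) (hM0 : ∀ u v, M 0 u v = ν v)
    (hidle : ∀ i : Fin K, ∀ u v, M i.succ u v = if v = u then 1 else 0) (hw0 : ∀ k, 0 ≤ w k) (hw00 : 0 < w 0) (hw1 : ∑ k, w k = 1) (ht0 : 0 < t) (ht1 : t < 1)
    (hP : ∀ x y, P x y = t * ptGraphSwap (fun _ : Fin (K + 1) => ν) e (fun _ => Equiv.refl S) x y + (1 - t) * prodKernel w M x y)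
    {c : Fin (K + 1) → ℝ} {ρ cmin Δ D : ℝ} (hρ0 : 0 < ρ) (hρ1 : ρ < 1) (hcmin : 0 < cmin) (hcge : ∀ k, cmin ≤ c k)
    (hvertex : ∀ k : Fin (K + 1), t / m * ∑ r : Fin m, ((if k = (e r).1 then c (e r).2 - c (e r).1 else 0) + (if k = (e r).2 then c (e r).1 - c (e r).2 else 0))
      - (if k = 0 then (1 - t) * w 0 * c 0 else 0) = -ρ * c k)
    (hΔ : ∀ r : Fin m, (c (e r).1 - c (e r).2) ^ 2 ≤ Δ) (hD0 : 0 < D) (hD : (t * Δ + (1 - t) * w 0 * c 0 ^ 2) / ρ ≤ D ^ 2) (u : S) :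
    (1 - ρ) / ρ * Real.log ((1 - ν u) * (∑ k : Fin (K + 1), c k) / (4 * D)) ≤ (mixingTime P (tensorFun (fun _ : Fin (K + 1) => ν)) (1 / 4) : ℝ)
      ∧ mixingTime P (tensorFun (fun _ : Fin (K + 1) => ν)) (1 / 4) ≤ ⌈1 / ρ * Real.log ((∑ k : Fin (K + 1), c k) / (cmin * (1 / 4)))⌉₊ := by
  have hM := (homLadder_kernels hν hν1 hM0 hidle).1
  have hw01 : w 0 ≤ 1 := by
    calc w 0 ≤ ∑ k, w k := Finset.single_le_sum (fun k _ => hw0 k) (mem_univ 0)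
      _ = 1 := hw1
  have hPl : ∀ x y, P x y = t * ptGraphProposal e (fun _ => Equiv.refl S) x y + (1 - t) * w 0 * coordKernel M 0 x y + (1 - t - (1 - t) * w 0) * (if y = x then 1 else 0) :=
    fun x y => by rw [hP, graphScheme_lazyForm e hm he hν hidle hw1]
  -- convergence from the ceiling itself
  have hceil := graphScheme_mixingTime_le_mode e (h := (1 - t) * w 0) hm he ht0 (mul_pos (by linarith) hw00) (by nlinarith) hν hν1 hM hM0 hPl hρ0 hρ1.le hcmin hcge
    hvertex (show (0 : ℝ) < 1 / 4 by norm_num)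
  have hconv : ∃ t₀, worstTvDist P (tensorFun (fun _ : Fin (K + 1) => ν)) t₀ ≤ 1 / 4 :=
    ⟨_, graphScheme_worstTvDist_le_of_ge_log e (h := (1 - t) * w 0) hm he ht0 (mul_pos (by linarith) hw00) (by nlinarith) hν hν1 hM hM0 hPl hρ0 hρ1.le hcmin hcge
      hvertex (show (0 : ℝ) < 1 / 4 by norm_num) (Nat.le_ceil _)⟩
  have hfloor := graphScheme_mode_mixingTime_ge e hm he hν hν1 hM0 hidle hw0 hw1 ht0 ht1 hP hvertex hρ0 hρ1 hΔ hconv hD0 hD u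
  have hsum0 : 0 ≤ ∑ k : Fin (K + 1), c k := sum_nonneg fun k _ => le_trans hcmin.le (hcge k)
  rw [abs_of_nonneg hsum0] at hfloor
  exact ⟨hfloor, hceil⟩

end Summit.Ventures.LatticeQCDFlow.Scaling

end
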